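import Literature.AlgebraicGeometry.Resolution.QuadraticSequenceDimOneExistence
import Mathlib.RingTheory.Valuation.LocalSubring

/-!
# A valuation ring dominating a one-dimensional local domain with Dedekind normalisation is a
# local ring of the normalisation (Herrmann–Ikeda–Orbanz (30.2): "`V = N_n`")

Helper file for the stub `stub_curveMonomialization` of the line `pfaff-line-log-final-forms`
(crux `Valuative.LuAlphaPTorsor`, item `stmt-ResolutionOfSingularities-0641`).

Herrmann–Ikeda–Orbanz, *Equimultiplicity and Blowing up*, proof of Thm. (30.2): "Let `N` be the
normalization of `R̄` and let `n = m_V ∩ N`. … we conclude that `V = N_n`." The tree's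
`exists_valuationSubring_dominates_of_finite_integralClosure`
(`QuadraticSequenceDimOneExistence.lean`) proves this for SOME valuation ring (the local ring of
a chosen maximal ideal of `N`); here it is PROVED for a GIVEN one
(`integralClosure_le_and_le_locAtCentre`): if `A` is a one-dimensional Noetherian domain, not a
field, with fraction field `L`, and `O'' ≠ L` is a valuation ring of `L` containing `A` in which
the non-units of `A` have positive value, then the integral closure `N` of `A` in `L` (a Dedekind
domain by Krull–Akizuki, `KrullAkizuki_holds`) lies in `O''`, and `O'' ⊆ N_{𝔪_{O''} ∩ N}`
(`locAtCentre`): the localisation `N_n` at the nonzero prime `n = 𝔪_{O''} ∩ N` is a discrete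
valuation ring of `L` inside `O''`, hence equal to it. No finiteness of `N` is needed for this
step. [cite: HerrmannIkedaOrbanz1988, Thm. (30.2) (proof)]
-/

set_option linter.dupNamespace false

namespace Summit.ResolutionOfSingularities.ResolutionOfSingularities.Theorems.PfaffLine.CurveMono

open IsLocalRing Literature.AlgebraicGeometry.Resolution Literature.RingTheory.DiscreteValuationRing

variable {L : Type} [Field L]

/-- **"`V = N_n`" (Herrmann–Ikeda–Orbanz, proof of Thm. (30.2)).** Let `A` be a one-dimensional
Noetherian domain, not a field, with fraction field `L`, and `O'' ≠ L` a valuation ring of `L`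
containing `A` such that the non-units of `A` have positive value. Then the integral closure `N`
of `A` in `L` lies in `O''` and `O'' ⊆ N_{𝔪_{O''} ∩ N}` (every element of `O''` is a quotient
`a/t` of elements of `N` with `t` a unit of `O''`): `N` is Dedekind (Krull–Akizuki), the centre
`n` of `O''` on `N` is a nonzero prime, and the discrete valuation ring `N_n ⊆ O''` of `L` is
maximal among proper subrings. [cite: HerrmannIkedaOrbanz1988, Thm. (30.2) (proof)] -/
theorem integralClosure_le_and_le_locAtCentre {A : Type} [CommRing A] [IsDomain A]
    [IsNoetherianRing A] [Ring.DimensionLEOne A] (hA : ¬ IsField A) [Algebra A L]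
    [IsFractionRing A L] (O'' : ValuationSubring L) (htop : O'' ≠ ⊤)
    (hAO : ∀ a, algebraMap A L a ∈ O'')
    (hdom : ∀ a : A, ¬ IsUnit a → O''.valuation (algebraMap A L a) < 1) :
    (integralClosure A L).toSubring ≤ O''.toSubring ∧
      O''.toSubring ≤ locAtCentre (integralClosure A L).toSubring O'' := by
  classical
  haveI : IsDedekindDomain (integralClosure A L) :=
    KrullAkizuki_holds.isDedekindDomain_integralClosure hA L L
  have hinj : Function.Injective (algebraMap A L) := IsFractionRing.injective A L
  -- `N ⊆ O''`: elements integral over `A ⊆ O''` are integral over the normal ring `O''`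
  have hNO : (integralClosure A L).toSubring ≤ O''.toSubring := by
    intro x hx
    have hxint : IsIntegral A x := hx
    let φ : A →+* O'' := (algebraMap A L).codRestrict O'' hAO
    have hφ : (algebraMap O'' L).comp φ = (RingHom.id L).comp (algebraMap A L) :=
      RingHom.ext fun _ => rfl
    have hxO : IsIntegral O'' x := hxint.map_of_comp_eq φ (RingHom.id L) hφ
    obtain ⟨y, hy⟩ := IsIntegrallyClosed.algebraMap_eq_of_integral hxO
    rw [← hy]
    exact y.2
  refine ⟨hNO, ?_⟩
  -- the centre `n` of `O''` on `N`, a nonzero prime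
  set Nc := integralClosure A L with hNc
  let ι : Nc →+* O'' := (algebraMap Nc L).codRestrict O'' fun x => hNO x.2
  set n : Ideal Nc := (maximalIdeal O'').comap ι with hn
  haveI hnp : n.IsPrime := Ideal.comap_isPrime _ _
  have hmemn : ∀ x : Nc, x ∈ n ↔ O''.valuation (x : L) < 1 := fun x => by
    rw [hn, Ideal.mem_comap, ValuationSubring.valuation_lt_one_iff]
    rfl
  have hval1 : ∀ x : Nc, x ∉ n → O''.valuation (x : L) = 1 := fun x hx =>
    le_antisymm ((O''.valuation_le_one_iff _).mpr (hNO x.2)) (not_lt.mp ((hmemn x).not.mp hx))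
  have hn0 : n ≠ ⊥ := by
    obtain ⟨M, hM⟩ := Ideal.exists_maximal A
    have hM0 : M ≠ ⊥ := Ring.ne_bot_of_isMaximal_of_not_isField hM hA
    obtain ⟨a, haM, ha0⟩ := (Submodule.ne_bot_iff M).mp hM0
    have hau : ¬ IsUnit a := fun hu => hM.ne_top (Ideal.eq_top_of_isUnit_mem _ haM hu)
    refine (Submodule.ne_bot_iff n).mpr ⟨algebraMap A Nc a, (hmemn _).mpr (hdom a hau), ?_⟩
    intro h
    apply ha0
    apply hinj
    have e := congrArg (fun x : Nc => (x : L)) h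
    rw [map_zero]
    exact e
  -- the discrete valuation ring `N_n ⊆ O''` of `L`
  haveI : IsFractionRing Nc L := integralClosure.isFractionRing_of_finite_extension L L
  let 𝒪 : Subalgebra Nc L :=
    Localization.subalgebra.ofField L n.primeCompl n.primeCompl_le_nonZeroDivisors
  haveI : IsLocalization.AtPrime 𝒪 n := Localization.subalgebra.isLocalization_ofField L _ _
  haveI : IsDiscreteValuationRing 𝒪 :=
    IsLocalization.AtPrime.isDiscreteValuationRing_of_dedekind_domain _ hn0 𝒪
  haveI : IsFractionRing 𝒪 L := by
    refine IsFractionRing.of_field (R := 𝒪) (K := L) (surj := fun z => ?_)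
    obtain ⟨x, y, -, rfl⟩ := IsFractionRing.div_surjective (A := Nc) z
    exact ⟨⟨algebraMap Nc L x, 𝒪.algebraMap_mem x⟩, ⟨algebraMap Nc L y, 𝒪.algebraMap_mem y⟩, rfl⟩
  have hmem_or : ∀ z : L, z ∈ 𝒪.toSubring ∨ z⁻¹ ∈ 𝒪.toSubring := fun z => by
    rcases ValuationRing.isInteger_or_isInteger 𝒪 z with ⟨y, hy⟩ | ⟨y, hy⟩
    · exact Or.inl (hy ▸ y.2)
    · exact Or.inr (hy ▸ y.2)
  let W𝒪 : ValuationSubring L := ValuationSubring.ofSubring 𝒪.toSubring hmem_or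
  have hle : W𝒪 ≤ O'' := by
    intro z hz
    obtain ⟨a, t, ht, rfl⟩ := (show z ∈ 𝒪 from hz)
    refine O''.mul_mem _ _ (hNO a.2) ?_
    rw [← O''.valuation_le_one_iff, map_inv₀]
    change (O''.valuation (t : L))⁻¹ ≤ 1
    rw [hval1 t ht, inv_one]
  -- `dim N_n ≤ 1` and `O'' ≠ L`, so `N_n = O''`
  have hdvr : IsDiscreteValuationRing W𝒪 :=
    IsDiscreteValuationRing.RingEquivClass.isDiscreteValuationRing (A := 𝒪) (B := W𝒪)
      ({ toFun := fun x => ⟨x.1, x.2⟩, invFun := fun x => ⟨x.1, x.2⟩, left_inv := fun _ => rfl,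
         right_inv := fun _ => rfl, map_mul' := fun _ _ => rfl, map_add' := fun _ _ => rfl } :
        𝒪 ≃+* W𝒪)
  haveI : Ring.KrullDimLE 1 W𝒪 := by haveI := hdvr; infer_instance
  have heq : W𝒪 = O'' := ValuationSubring.eq_of_le_of_ne_top W𝒪 hle htop
  -- conclusion: the elements of `O'' = N_n` are fractions with unit denominators
  intro z hz
  have hz' : z ∈ W𝒪 := by rw [heq]; exact hz
  obtain ⟨a, t, ht, rfl⟩ := (show z ∈ 𝒪 from hz')
  exact ⟨(a : L), a.2, (t : L), t.2, hval1 t ht, by rw [div_eq_mul_inv]; rfl⟩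

end Summit.ResolutionOfSingularities.ResolutionOfSingularities.Theorems.PfaffLine.CurveMono

namespace Summit.ResolutionOfSingularities.ResolutionOfSingularities.Theorems.PfaffLine

/-- **Registered sub-goal `curveMono_integralClosure_le_locAtCentre`** (universe `0`, for
`--supports` registration): Herrmann–Ikeda–Orbanz's "`V = N_n`" for a given valuation ring `V`
dominating a one-dimensional Noetherian domain. [cite: HerrmannIkedaOrbanz1988, Thm. (30.2) (proof)] -/
theorem curveMono_integralClosure_le_locAtCentre : ∀ {L : Type} [Field L] {A : Type} [CommRing A] [IsDomain A] [IsNoetherianRing A] [Ring.DimensionLEOne A], ¬ IsField A → ∀ [Algebra A L] [IsFractionRing A L] (O'' : ValuationSubring L), O'' ≠ ⊤ → (∀ a, algebraMap A L a ∈ O'') → (∀ a : A, ¬ IsUnit a → O''.valuation (algebraMap A L a) < 1) → (integralClosure A L).toSubring ≤ O''.toSubring ∧ O''.toSubring ≤ Literature.AlgebraicGeometry.Resolution.locAtCentre (integralClosure A L).toSubring O'' := by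
  intro L _ A _ _ _ _ hA _ _ O'' htop hAO hdom
  exact CurveMono.integralClosure_le_and_le_locAtCentre hA O'' htop hAO hdom

end Summit.ResolutionOfSingularities.ResolutionOfSingularities.Theorems.PfaffLine
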